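import Literature.Topology.FourManifolds.InvertedGermExtension
import Mathlib.Analysis.InnerProductSpace.PiL2
import Mathlib.Analysis.Calculus.Deriv.MeanValue
import Mathlib.Geometry.Manifold.Instances.Real

/-!
# Helper `helper_handlebodyChart_modelHandles` (M3: handle structure of the model dotted handlebody `D_k`)
# of line `mk_friends` for crux `DcrGap` — radial pushes are diffeomorphisms
(item stmt-SmoothPoincare4-16128, route route-SmoothPoincare4-DottedCircleRasmussen)

**Registered piece `helper_handlebodyChart_modelHandles_radialDiffeo` of the model lemma M3.**  The squeeze
`κ` of M3 (hypothesis `squeeze` of the registered reduction `helper_handlebodyChart_modelHandles_of_data`)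
is a composition of pushes of `ℝ⁴ = ℂ²` which are RADIAL either in the `z`-plane about a centre (a hole
centre, or the base centre) or in the `w`-plane about `0`, with a smooth compactly supported amplitude:
`Φ(x) = x + b(x) P(x - q)` with `P` an idempotent linear map (a coordinate projection).  This file proves
the criterion that makes them diffeomorphisms: if `1 + b(x) + Db(x)[P(x - q)] > 0` everywhere — the
derivative of `t ↦ t(1 + b)` along each ray `q + s + t r` (`P s = 0`, `P r = r`) — then `Φ` is a
diffeomorphism of the (finite-dimensional) space (`ModelHandles.exists_radial_diffeomorph`): along each ray
the map is a strictly increasing self-map of `[0, ∞)` onto itself (`ModelHandles.radial_ray_strictMono`,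
and `b = 0` far out), whence bijectivity; the differential is injective by the same computation; conclude by
the global inverse function theorem `Literature.Topology.FourManifolds.diffeomorphOfContDiffBijective`.
Such `Φ` commute with every linear isometry fixing `q`, commuting with `P` and preserving `b` (read off
the formula), e.g. with the rotations of the `w`-plane when `b` depends on `|w|` only.

No definitions, no named facts, no `sorry`.

References: M. W. Hirsch, *Differential Topology* (1976), Ch. 8 §1 (radial isotopies) [HirschDT1976].
-/

-- the prescribed namespace `Summit.<P>.<Sub>.…` duplicates `SmoothPoincare4` (P = Sub)
set_option linter.dupNamespace false
set_option linter.style.longLine false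

noncomputable section

open scoped Manifold ContDiff Topology
open Function Set Metric Filter

namespace Summit.SmoothPoincare4.SmoothPoincare4.Theorems.DcrGap.MkFriends

namespace ModelHandles

variable {F : Type*} [NormedAddCommGroup F] [NormedSpace ℝ F]

/-- **Radial pushes along an idempotent direction field: the one-dimensional reduction.**  For
`Φ(x) = x + b(x) P(x - q)` with `P` idempotent and `1 + b + Db[P(· - q)] > 0`, the function
`h(t) = t (1 + b(q + s + t r))` along the ray `t ↦ q + s + t r` (`P s = 0`, `P r = r`) is strictly
increasing. [folklore] -/
theorem radial_ray_strictMono (P : F →L[ℝ] F) (q : F) {b : F → ℝ}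
    (hb : ContDiff ℝ ∞ b) (hpos : ∀ x, 0 < 1 + b x + fderiv ℝ b x (P (x - q)))
    (s r : F) (hs : P s = 0) (hr : P r = r) :
    StrictMono fun t : ℝ => t * (1 + b (q + s + t • r)) := by
  have hγ : ∀ t : ℝ, HasDerivAt (fun t : ℝ => q + s + t • r) r t := fun t => by
    simpa using ((hasDerivAt_id t).smul_const r).const_add (q + s)
  have hd : ∀ t : ℝ, HasDerivAt (fun t : ℝ => t * (1 + b (q + s + t • r)))
      (1 * (1 + b (q + s + t • r)) + t * fderiv ℝ b (q + s + t • r) r) t := by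
    intro t
    have hbd : HasFDerivAt b (fderiv ℝ b (q + s + t • r)) (q + s + t • r) :=
      (hb.differentiable (by simp) _).hasFDerivAt
    have h1 : HasDerivAt (fun t : ℝ => b (q + s + t • r)) (fderiv ℝ b (q + s + t • r) r) t :=
      hbd.comp_hasDerivAt t (hγ t)
    exact (hasDerivAt_id t).mul (h1.const_add 1)
  refine strictMono_of_deriv_pos fun t => ?_
  rw [(hd t).deriv]
  have hPt : P (q + s + t • r - q) = t • r := by
    rw [show q + s + t • r - q = s + t • r by abel, map_add, map_smul, hs, hr, zero_add]
  have := hpos (q + s + t • r)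
  rw [hPt, map_smul, smul_eq_mul] at this
  linarith

/-- **A radial push along an idempotent direction field is a diffeomorphism.**  Let `P` be an idempotent
continuous linear map of a finite-dimensional space (`P² = P`, e.g. a coordinate projection), `q` a
point, and `b` a smooth function vanishing outside a bounded set with `1 + b(x) + Db(x)[P(x - q)] > 0`
everywhere.  Then `Φ(x) = x + b(x) P(x - q)` — which fixes the component of `x - q` in `ker P` and
rescales its component in `range P` by the factor `1 + b(x)` — is a diffeomorphism: along each ray
`t ↦ q + s + t r` the map is `t ↦ t(1 + b)`, strictly increasing (the displayed condition is its
derivative) from `0` to `∞`, which gives bijectivity, and the differential is injective by the same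
computation; conclude by the global inverse function theorem (`diffeomorphOfContDiffBijective`).
The squeezes of the model handlebody (radial in `z` about a hole centre or about the base centre, radial
in `w`) are of this form. [folklore] -/
theorem exists_radial_diffeomorph [FiniteDimensional ℝ F] (P : F →L[ℝ] F) (hP : ∀ x, P (P x) = P x)
    (q : F) {b : F → ℝ} (hb : ContDiff ℝ ∞ b) (hR : ∃ R : ℝ, ∀ x, R ≤ ‖x‖ → b x = 0)
    (hpos : ∀ x, 0 < 1 + b x + fderiv ℝ b x (P (x - q))) :
    ∃ Φ : F ≃ₘ⟮𝓘(ℝ, F), 𝓘(ℝ, F)⟯ F, ∀ x, Φ x = x + b x • P (x - q) := by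
  obtain ⟨R, hRb⟩ := hR
  set Φf : F → F := fun x => x + b x • P (x - q) with hΦf
  -- decomposition `x = q + s + r`, `P s = 0`, `P r = r`
  have hdec : ∀ x, x = q + (x - q - P (x - q)) + P (x - q) := fun x => by abel
  have hPs : ∀ x, P (x - q - P (x - q)) = 0 := fun x => by rw [map_sub, hP, sub_self]
  have hPr : ∀ x, P (P (x - q)) = P (x - q) := fun x => hP _
  -- the ray function
  have hmono := fun s r hs hr => radial_ray_strictMono P q hb hpos s r hs hr
  -- `Φ` on a ray
  have hΦray : ∀ s r : F, P s = 0 → P r = r → ∀ t : ℝ,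
      Φf (q + s + t • r) = q + s + (t * (1 + b (q + s + t • r))) • r := by
    intro s r hs hr t
    simp only [hΦf]
    rw [show q + s + t • r - q = s + t • r by abel, map_add, map_smul, hs, hr, zero_add, smul_smul]
    have e : (t * (1 + b (q + s + t • r))) • r = t • r + (b (q + s + t • r) * t) • r := by
      rw [← add_smul]; congr 1; ring
    rw [e]; abel
  -- `1 + b > 0`
  have hb1 : ∀ x, 0 < 1 + b x := by
    intro x
    have h := hmono _ _ (hPs x) (hPr x) (show (0 : ℝ) < 1 by norm_num)
    simp only [zero_smul, add_zero, zero_mul, one_smul, one_mul] at h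
    rwa [← hdec x] at h
  -- injectivity
  have hinj : Injective Φf := by
    intro x y hxy
    -- equal `ker P` components
    have hker : x - q - P (x - q) = y - q - P (y - q) := by
      have h1 : ∀ z, Φf z - q - P (Φf z - q) = z - q - P (z - q) := fun z => by
        simp only [hΦf, add_sub_right_comm, map_add, map_smul, hP]
        abel
      rw [← h1 x, ← h1 y, hxy]
    -- equal rescaled `range P` components
    have hran : (1 + b x) • P (x - q) = (1 + b y) • P (y - q) := by
      have h1 : ∀ z, P (Φf z - q) = (1 + b z) • P (z - q) := fun z => by
        simp only [hΦf, add_sub_right_comm, map_add, map_smul, hP, add_smul, one_smul]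
      rw [← h1 x, ← h1 y, hxy]
    set s := x - q - P (x - q) with hsdef
    set r := P (x - q) with hrdef
    have hs : P s = 0 := hPs x
    have hr : P r = r := hPr x
    -- `y` lies on the ray of `x`
    set lam : ℝ := (1 + b x) / (1 + b y) with hlam
    have hlam0 : 0 < lam := div_pos (hb1 x) (hb1 y)
    have hry : P (y - q) = lam • r := by
      rw [hlam, div_eq_inv_mul, mul_smul, hran, smul_smul, inv_mul_cancel₀ (hb1 y).ne', one_smul]
    have hy : y = q + s + lam • r := by rw [hdec y, ← hker, hry]
    have hx : x = q + s + (1 : ℝ) • r := by rw [one_smul]; exact hdec x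
    -- the ray function takes the same value at `1` and at `lam`
    have hval : (1 : ℝ) * (1 + b (q + s + (1 : ℝ) • r)) = lam * (1 + b (q + s + lam • r)) := by
      rw [← hx, ← hy, one_mul, hlam, div_mul_cancel₀ _ (hb1 y).ne']
    have hl1 : lam = 1 := ((hmono s r hs hr).injective hval).symm
    rw [hy, hx, hl1]
  -- surjectivity
  have hsurj : Surjective Φf := by
    intro y
    set s := y - q - P (y - q) with hsdef
    set r := P (y - q) with hrdef
    have hs : P s = 0 := hPs y
    have hr : P r = r := hPr y
    by_cases hr0 : r = 0
    · refine ⟨y, ?_⟩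
      simp only [hΦf]
      rw [← hrdef, hr0, smul_zero, add_zero]
    -- the ray function is `≥ 1` far out and `0` at `0`
    set h : ℝ → ℝ := fun t => t * (1 + b (q + s + t • r)) with hh
    have hcont : Continuous h :=
      continuous_id.mul (continuous_const.add (hb.continuous.comp
        (continuous_const.add (continuous_id.smul continuous_const))))
    obtain ⟨T, hT1, hT⟩ : ∃ T : ℝ, 1 ≤ T ∧ R ≤ ‖q + s + T • r‖ := by
      refine ⟨max 1 ((R + ‖q + s‖) / ‖r‖), le_max_left _ _, ?_⟩
      have hrn : 0 < ‖r‖ := norm_pos_iff.2 hr0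
      have h1 : (R + ‖q + s‖) / ‖r‖ * ‖r‖ ≤ max 1 ((R + ‖q + s‖) / ‖r‖) * ‖r‖ :=
        mul_le_mul_of_nonneg_right (le_max_right _ _) hrn.le
      rw [div_mul_cancel₀ _ hrn.ne'] at h1
      have h2 := norm_sub_norm_le (max 1 ((R + ‖q + s‖) / ‖r‖) • r) (-(q + s))
      rw [norm_neg, norm_smul, Real.norm_of_nonneg (le_trans zero_le_one (le_max_left _ _)),
        sub_neg_eq_add, add_comm (max 1 _ • r)] at h2
      linarith
    have hT' : 1 ≤ h T := by
      simp only [hh]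
      rw [hRb _ hT, add_zero, mul_one]
      exact hT1
    have h0 : h 0 = 0 := by simp [hh]
    obtain ⟨t, -, ht⟩ : ∃ t ∈ Icc (0 : ℝ) T, h t = 1 :=
      intermediate_value_Icc (le_trans zero_le_one hT1) hcont.continuousOn ⟨by rw [h0]; norm_num, hT'⟩
    refine ⟨q + s + t • r, ?_⟩
    rw [hΦray s r hs hr t]
    simp only [hh] at ht
    rw [ht, one_smul]
    exact (hdec y).symm
  -- the differential is injective
  have hd : ∀ x, Injective (fderiv ℝ Φf x) := by
    intro x
    have hbd : HasFDerivAt b (fderiv ℝ b x) x := (hb.differentiable (by simp) _).hasFDerivAt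
    have hlin : HasFDerivAt (fun x => P (x - q)) P x := by
      have h1 : HasFDerivAt (fun x : F => x - q) (ContinuousLinearMap.id ℝ F) x :=
        (hasFDerivAt_id x).sub_const q
      have h2 := P.hasFDerivAt.comp x h1
      rw [P.comp_id] at h2
      exact h2
    have hF : HasFDerivAt Φf (ContinuousLinearMap.id ℝ F +
        (b x • P + (fderiv ℝ b x).smulRight (P (x - q)))) x :=
      (hasFDerivAt_id x).add (hbd.smul hlin)
    rw [hF.fderiv]
    intro v w hvw
    rw [← sub_eq_zero]
    set u := v - w with hu
    set r := P (x - q) with hr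
    have hzero : u + (b x • P u + (fderiv ℝ b x u) • r) = 0 := by
      have h1 : (ContinuousLinearMap.id ℝ F + (b x • P + (fderiv ℝ b x).smulRight r)) u = 0 := by
        rw [hu, map_sub, sub_eq_zero]; exact hvw
      simpa only [add_apply, ContinuousLinearMap.id_apply, FunLike.coe_smul, Pi.smul_apply,
        ContinuousLinearMap.smulRight_apply] using h1
    -- `u = P u`
    have hPu : P u = u := by
      have h1 := congrArg (fun y => y - P y) hzero
      simp only [map_add, map_smul, hP, hr, map_zero, sub_zero] at h1
      have h2 : u + (b x • P u + (fderiv ℝ b x) u • P (x - q)) -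
          (P u + (b x • P u + (fderiv ℝ b x) u • P (x - q))) = u - P u := by abel
      rw [h2] at h1
      exact (sub_eq_zero.1 h1).symm
    rw [hPu] at hzero
    -- `(1 + b x) u = -(Db[u]) r`
    have h1 : (1 + b x) • u = -((fderiv ℝ b x u) • r) := by
      rw [add_smul, one_smul]
      exact eq_neg_of_add_eq_zero_left (by rw [add_assoc]; exact hzero)
    by_cases hr0 : r = 0
    · rw [hr0, smul_zero, neg_zero] at h1
      exact (smul_eq_zero.1 h1).resolve_left (hb1 x).ne'
    · set μ : ℝ := -(fderiv ℝ b x u) / (1 + b x) with hμ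
      have h2 : u = μ • r := by
        calc u = (1 + b x)⁻¹ • ((1 + b x) • u) := by
              rw [smul_smul, inv_mul_cancel₀ (hb1 x).ne', one_smul]
          _ = μ • r := by
              rw [h1, smul_neg, smul_smul, ← neg_smul, hμ]
              congr 1
              field_simp
      have h3 : fderiv ℝ b x u = μ * fderiv ℝ b x r := by
        conv_lhs => rw [h2]
        rw [map_smul, smul_eq_mul]
      have h4 : (μ * (1 + b x + fderiv ℝ b x r)) • r = 0 := by
        have : (μ * (1 + b x + fderiv ℝ b x r)) • r = (1 + b x) • (μ • r) + (μ * fderiv ℝ b x r) • r := by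
          rw [smul_smul, ← add_smul]; congr 1; ring
        rw [this, ← h2, h1, h3, neg_add_cancel]
      have hμ0 : μ = 0 := by
        have := (smul_eq_zero.1 h4).resolve_right hr0
        exact (mul_eq_zero.1 this).resolve_right (hpos x).ne'
      rw [h2, hμ0, zero_smul]
  have hΦs : ContDiff ℝ ∞ Φf := contDiff_id.add (hb.smul (P.contDiff.comp (contDiff_id.sub contDiff_const)))
  exact ⟨Literature.Topology.FourManifolds.diffeomorphOfContDiffBijective Φf hΦs ⟨hinj, hsurj⟩ hd, fun x => rfl⟩

end ModelHandles

/-- **Registered piece `helper_handlebodyChart_modelHandles_radialDiffeo` of the model lemma M3 (radial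
pushes of `ℝ⁴` along an idempotent direction field are diffeomorphisms)**: for `P² = P`, `b` smooth,
vanishing far out, with `1 + b + Db[P(· - q)] > 0`, the map `x ↦ x + b(x) P(x - q)` is a diffeomorphism of
`ℝ⁴` (`ModelHandles.exists_radial_diffeomorph`). [folklore] -/
theorem helper_handlebodyChart_modelHandles_radialDiffeo : ∀ (P : EuclideanSpace ℝ (Fin 4) →L[ℝ] EuclideanSpace ℝ (Fin 4)), (∀ x, P (P x) = P x) → ∀ (q : EuclideanSpace ℝ (Fin 4)) (b : EuclideanSpace ℝ (Fin 4) → ℝ), ContDiff ℝ ((⊤ : ℕ∞) : WithTop ℕ∞) b → (∃ R : ℝ, ∀ x, R ≤ ‖x‖ → b x = 0) → (∀ x, 0 < 1 + b x + fderiv ℝ b x (P (x - q))) → ∃ Φ : EuclideanSpace ℝ (Fin 4) ≃ₘ⟮𝓡 4, 𝓡 4⟯ EuclideanSpace ℝ (Fin 4), ∀ x, Φ x = x + b x • P (x - q) :=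
  fun P hP q _ hb hR hpos => ModelHandles.exists_radial_diffeomorph P hP q hb hR hpos

end Summit.SmoothPoincare4.SmoothPoincare4.Theorems.DcrGap.MkFriends

end
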